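import Mathlib
import HarnessLib

/-!
# Markov truncation and geometric class sums: helper file `Aux` for the stub `stub_pairExpectation`
of line SketchIdeator1 (skeleton floor-russo), crux LowPointBookkeeping

Helper file for the crux skeleton `Cruxes/LowPointBookkeeping/Lines/SketchIdeator1.lean`
(item `stmt-CriticalPhenomena-14713`,
`Summit.CriticalPhenomena.PercolationContinuityZ3.Theses.PercLowPointHalfSpace.LowPointBookkeeping`),
stub `stub_pairExpectation` (Markov bookkeeping of the window pair count). Pure measure theory,
no percolation: the two abstract devices of the bookkeeping.

* `lintegral_mul_mul_indicator_le` — **Markov truncation** of a product of two bounded counts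
  `a ≤ A`, `b ≤ B` on a measurable event `G`: splitting `Ω` into `{a < θ_a} ∩ {b < θ_b}` and its
  complement, `∫ a b 1_G dμ ≤ θ_a θ_b μ(G) + A B (μ(θ_a ≤ a) + μ(θ_b ≤ b))`, stated with the three
  probabilities replaced by arbitrary real upper bounds and the right-hand side as `ENNReal.ofReal`
  of a real number (the form in which the two-arm bound and the mass tails are consumed);
  `lintegral_mul_const_indicator_le` is the one-factor version (second factor a constant `K`).
* `lintegral_sum_le_of_geom`, `lintegral_tsum_le_of_geom` — summing class bounds of geometric shape
  `∫ F_j ≤ K x^j` (`0 ≤ x < 1`) over finitely many / all classes `j`: `≤ K / (1 - x)`.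
-/

noncomputable section

namespace Summit.CriticalPhenomena.PercolationContinuityZ3.Theorems.FloorRusso.PairExpectation

open MeasureTheory
open scoped ENNReal

/-- Pointwise Markov truncation of a product of two bounded counts on an event. -/
theorem mul_mul_indicator_le_pointwise {Ω : Type*} (a b : Ω → ℕ) (G : Set Ω) {A B : ℕ}
    (haA : ∀ ω, a ω ≤ A) (hbB : ∀ ω, b ω ≤ B) (θa θb : ℝ) (ω : Ω) :
    (a ω : ℝ≥0∞) * (b ω : ℝ≥0∞) * G.indicator (fun _ => (1 : ℝ≥0∞)) ω ≤
      G.indicator (fun _ => ENNReal.ofReal θa * ENNReal.ofReal θb) ω +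
        ({ω | θa ≤ (a ω : ℝ)} ∪ {ω | θb ≤ (b ω : ℝ)}).indicator
          (fun _ => ((A : ℝ≥0∞) * (B : ℝ≥0∞))) ω := by
  by_cases hS : ω ∈ ({ω | θa ≤ (a ω : ℝ)} ∪ {ω | θb ≤ (b ω : ℝ)})
  · rw [Set.indicator_of_mem hS]
    refine le_add_left ?_
    calc (a ω : ℝ≥0∞) * (b ω : ℝ≥0∞) * G.indicator (fun _ => (1 : ℝ≥0∞)) ω
        ≤ (A : ℝ≥0∞) * (B : ℝ≥0∞) * 1 := by
          gcongr
          · exact_mod_cast haA ω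
          · exact_mod_cast hbB ω
          · exact Set.indicator_le_self' (fun _ _ => zero_le_one) ω
      _ = (A : ℝ≥0∞) * (B : ℝ≥0∞) := mul_one _
  · rw [Set.indicator_of_notMem hS, add_zero]
    simp only [Set.mem_union, Set.mem_setOf_eq, not_or, not_le] at hS
    have ha : (a ω : ℝ≥0∞) ≤ ENNReal.ofReal θa := by
      rw [← ENNReal.ofReal_natCast]
      exact ENNReal.ofReal_le_ofReal hS.1.le
    have hb : (b ω : ℝ≥0∞) ≤ ENNReal.ofReal θb := by
      rw [← ENNReal.ofReal_natCast]
      exact ENNReal.ofReal_le_ofReal hS.2.le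
    by_cases hG : ω ∈ G
    · rw [Set.indicator_of_mem hG, Set.indicator_of_mem hG, mul_one]
      gcongr
    · rw [Set.indicator_of_notMem hG, Set.indicator_of_notMem hG, mul_zero]

/-- **Markov truncation (two factors)**: for counts `a ≤ A`, `b ≤ B`, a measurable event `G` and
thresholds `θa, θb ≥ 0`,
`∫ a b 1_G ≤ θa θb P(G) + A B (P(θa ≤ a) + P(θb ≤ b))`, with the three probabilities replaced by
any upper bounds. -/
theorem lintegral_mul_mul_indicator_le {Ω : Type*} [MeasurableSpace Ω] (μ : Measure Ω)
    [IsFiniteMeasure μ] (a b : Ω → ℕ) {G : Set Ω} (hG : MeasurableSet G) {A B : ℕ}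
    (haA : ∀ ω, a ω ≤ A) (hbB : ∀ ω, b ω ≤ B) {θa θb pG pa pb : ℝ} (hθa : 0 ≤ θa) (hθb : 0 ≤ θb)
    (hpG : μ.real G ≤ pG) (hpa : μ.real {ω | θa ≤ (a ω : ℝ)} ≤ pa)
    (hpb : μ.real {ω | θb ≤ (b ω : ℝ)} ≤ pb) :
    ∫⁻ ω, (a ω : ℝ≥0∞) * (b ω : ℝ≥0∞) * G.indicator (fun _ => (1 : ℝ≥0∞)) ω ∂μ ≤
      ENNReal.ofReal (θa * θb * pG + (A : ℝ) * (B : ℝ) * (pa + pb)) := by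
  have hpG0 : 0 ≤ pG := measureReal_nonneg.trans hpG
  have hpa0 : 0 ≤ pa := measureReal_nonneg.trans hpa
  have hpb0 : 0 ≤ pb := measureReal_nonneg.trans hpb
  calc ∫⁻ ω, (a ω : ℝ≥0∞) * (b ω : ℝ≥0∞) * G.indicator (fun _ => (1 : ℝ≥0∞)) ω ∂μ
      ≤ ∫⁻ ω, G.indicator (fun _ => ENNReal.ofReal θa * ENNReal.ofReal θb) ω +
          ({ω | θa ≤ (a ω : ℝ)} ∪ {ω | θb ≤ (b ω : ℝ)}).indicator
            (fun _ => ((A : ℝ≥0∞) * (B : ℝ≥0∞))) ω ∂μ :=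
        lintegral_mono fun ω => mul_mul_indicator_le_pointwise a b G haA hbB θa θb ω
    _ = ENNReal.ofReal θa * ENNReal.ofReal θb * μ G +
          ∫⁻ ω, ({ω | θa ≤ (a ω : ℝ)} ∪ {ω | θb ≤ (b ω : ℝ)}).indicator
            (fun _ => ((A : ℝ≥0∞) * (B : ℝ≥0∞))) ω ∂μ := by
        rw [lintegral_add_left (measurable_const.indicator hG), lintegral_indicator_const hG]
    _ ≤ ENNReal.ofReal θa * ENNReal.ofReal θb * μ G +
          (A : ℝ≥0∞) * (B : ℝ≥0∞) * (μ {ω | θa ≤ (a ω : ℝ)} + μ {ω | θb ≤ (b ω : ℝ)}) := by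
        gcongr
        exact (lintegral_indicator_const_le _ _).trans (by gcongr; exact measure_union_le _ _)
    _ ≤ ENNReal.ofReal θa * ENNReal.ofReal θb * ENNReal.ofReal pG +
          (A : ℝ≥0∞) * (B : ℝ≥0∞) * (ENNReal.ofReal pa + ENNReal.ofReal pb) := by
        have h1 : μ G ≤ ENNReal.ofReal pG := by
          rw [← ENNReal.ofReal_toReal (measure_ne_top μ G)]
          exact ENNReal.ofReal_le_ofReal hpG
        have h2 : μ {ω | θa ≤ (a ω : ℝ)} ≤ ENNReal.ofReal pa := by
          rw [← ENNReal.ofReal_toReal (measure_ne_top μ _)]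
          exact ENNReal.ofReal_le_ofReal hpa
        have h3 : μ {ω | θb ≤ (b ω : ℝ)} ≤ ENNReal.ofReal pb := by
          rw [← ENNReal.ofReal_toReal (measure_ne_top μ _)]
          exact ENNReal.ofReal_le_ofReal hpb
        gcongr
    _ = ENNReal.ofReal (θa * θb * pG + (A : ℝ) * (B : ℝ) * (pa + pb)) := by
        rw [ENNReal.ofReal_add (by positivity) (by positivity), ENNReal.ofReal_mul (by positivity),
          ENNReal.ofReal_mul hθa, ENNReal.ofReal_mul (by positivity), ENNReal.ofReal_mul (by positivity),
          ENNReal.ofReal_add hpa0 hpb0, ENNReal.ofReal_natCast, ENNReal.ofReal_natCast]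

/-- **Markov truncation (one factor)**: for a count `a ≤ A`, a constant `K`, a measurable event
`G` and a threshold `θa ≥ 0`, `∫ a K 1_G ≤ θa (K + 1) P(G) + A K P(θa ≤ a)` (probabilities
replaced by upper bounds; the spurious `+ 1` and `+ 0` come from the two-factor version). -/
theorem lintegral_mul_const_indicator_le {Ω : Type*} [MeasurableSpace Ω] (μ : Measure Ω)
    [IsFiniteMeasure μ] (a : Ω → ℕ) (K : ℕ) {G : Set Ω} (hG : MeasurableSet G) {A : ℕ}
    (haA : ∀ ω, a ω ≤ A) {θa pG pa : ℝ} (hθa : 0 ≤ θa) (hpG : μ.real G ≤ pG)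
    (hpa : μ.real {ω | θa ≤ (a ω : ℝ)} ≤ pa) :
    ∫⁻ ω, (a ω : ℝ≥0∞) * (K : ℝ≥0∞) * G.indicator (fun _ => (1 : ℝ≥0∞)) ω ∂μ ≤
      ENNReal.ofReal (θa * ((K : ℝ) + 1) * pG + (A : ℝ) * (K : ℝ) * (pa + 0)) := by
  have hpb : μ.real {ω | (K : ℝ) + 1 ≤ ((fun _ : Ω => K) ω : ℝ)} ≤ 0 := by
    have h : {ω | (K : ℝ) + 1 ≤ ((fun _ : Ω => K) ω : ℝ)} = (∅ : Set Ω) :=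
      Set.eq_empty_of_forall_notMem fun ω hω => by
        simp only [Set.mem_setOf_eq] at hω
        linarith
    rw [h, measureReal_empty]
  exact lintegral_mul_mul_indicator_le μ a (fun _ => K) hG haA (fun _ => le_rfl) hθa
    (by positivity) hpG hpa hpb

/-- A finite geometric sum is bounded by the full series. -/
theorem sum_range_geom_le {x : ℝ} (h0 : 0 ≤ x) (h1 : x < 1) (n : ℕ) :
    ∑ j ∈ Finset.range n, x ^ j ≤ (1 - x)⁻¹ := by
  have h := geom_sum_Ico_le_of_lt_one (m := 0) (n := n) h0 h1
  rwa [pow_zero, one_div, ← Finset.range_eq_Ico] at h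

/-- Summing integral bounds of geometric shape over a finite range of classes. -/
theorem lintegral_sum_le_of_geom {Ω : Type*} [MeasurableSpace Ω] {μ : Measure Ω}
    (F : ℕ → Ω → ℝ≥0∞) (hF : ∀ j, Measurable (F j)) {K x : ℝ} (hK : 0 ≤ K) (hx0 : 0 ≤ x)
    (hx1 : x < 1) (h : ∀ j, ∫⁻ ω, F j ω ∂μ ≤ ENNReal.ofReal (K * x ^ j)) (n : ℕ) :
    ∫⁻ ω, ∑ j ∈ Finset.range n, F j ω ∂μ ≤ ENNReal.ofReal (K * (1 - x)⁻¹) := by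
  rw [lintegral_finsetSum _ fun j _ => hF j]
  calc ∑ j ∈ Finset.range n, ∫⁻ ω, F j ω ∂μ
      ≤ ∑ j ∈ Finset.range n, ENNReal.ofReal (K * x ^ j) := Finset.sum_le_sum fun j _ => h j
    _ = ENNReal.ofReal (∑ j ∈ Finset.range n, K * x ^ j) :=
        (ENNReal.ofReal_sum_of_nonneg fun j _ => by positivity).symm
    _ ≤ ENNReal.ofReal (K * (1 - x)⁻¹) := by
        refine ENNReal.ofReal_le_ofReal ?_
        rw [← Finset.mul_sum]
        exact mul_le_mul_of_nonneg_left (sum_range_geom_le hx0 hx1 n) hK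

/-- Summing integral bounds of geometric shape over all classes. -/
theorem lintegral_tsum_le_of_geom {Ω : Type*} [MeasurableSpace Ω] {μ : Measure Ω}
    (F : ℕ → Ω → ℝ≥0∞) (hF : ∀ j, Measurable (F j)) {K x : ℝ} (hK : 0 ≤ K) (hx0 : 0 ≤ x)
    (hx1 : x < 1) (h : ∀ j, ∫⁻ ω, F j ω ∂μ ≤ ENNReal.ofReal (K * x ^ j)) :
    ∫⁻ ω, ∑' j, F j ω ∂μ ≤ ENNReal.ofReal (K * (1 - x)⁻¹) := by
  rw [lintegral_tsum fun j => (hF j).aemeasurable]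
  calc ∑' j, ∫⁻ ω, F j ω ∂μ ≤ ∑' j, ENNReal.ofReal (K * x ^ j) := ENNReal.tsum_le_tsum h
    _ = ENNReal.ofReal (∑' j, K * x ^ j) :=
        (ENNReal.ofReal_tsum_of_nonneg (fun j => by positivity)
          ((summable_geometric_of_lt_one hx0 hx1).mul_left K)).symm
    _ = ENNReal.ofReal (K * (1 - x)⁻¹) := by
        rw [tsum_mul_left, tsum_geometric_of_lt_one hx0 hx1]

end Summit.CriticalPhenomena.PercolationContinuityZ3.Theorems.FloorRusso.PairExpectation

namespace Summit.CriticalPhenomena.PercolationContinuityZ3.Theorems.FloorRusso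

/-- **stub_pairExpectationAux** (registered sub-goal of this helper file): the finite geometric
sum bound `Σ_{j<n} x^j ≤ 1/(1-x)` for `0 ≤ x < 1` (`PairExpectation.sum_range_geom_le`), through
which the near-class bounds are summed. -/
theorem stub_pairExpectationAux :
    ∀ {x : ℝ}, 0 ≤ x → x < 1 → ∀ n : ℕ, ∑ j ∈ Finset.range n, x ^ j ≤ (1 - x)⁻¹ :=
  fun h0 h1 n => PairExpectation.sum_range_geom_le h0 h1 n

end Summit.CriticalPhenomena.PercolationContinuityZ3.Theorems.FloorRusso

end
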